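import Mathlib
import HarnessLib
import Summits.Ventures.LatticeQCDFlow.Exactness.ChargeSlabCorrelatorRP
import Summits.Ventures.LatticeQCDFlow.Scoring.SlabChargeDecomposition

/-!
# The slab-charge correlator of the Wilson measure is non-positive at EVERY time separation `2 ≤ s ≤ L − 2`, and the susceptibility is bounded by its contact terms: `E[Q²] ≤ L·(C(0) + 2C(1))`

HONEST FRAMING: exact (Metropolis-corrected) sampling algorithms for lattice gauge theory;
figures of merit are autocorrelation/cost numbers at stated couplings and volumes; no
continuum-physics claim.

Venture `LatticeQCDFlow` (cell pub-lqcd), topic `Exactness`, FANOUT row 21 (`su3-base`).  NEW WORK of the cell, def-free, the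
sequel of row 21's `Exactness/ChargeSlabCorrelatorRP` (reflection positivity: `⟨Q_m Q_{1−m}⟩_β ≤ 0` across the link plane for
`β ≥ 0`, `⟨Q_m Q_{−m}⟩_β ≤ 0` across the site plane for every `β`; `Q_t = Σ_{x : x₀ = t} P_x` the bare clover charge of the
slice `t`) and `Scoring/SlabChargeDecomposition` (time translations: `E[Q_a Q_b] = E[Q_{a+u} Q_{b+u}]`; `E[(Σ_x P_x)²] =
L·Σ_s E[Q_0 Q_s]`).  Nothing is cited as a fact; no number.  Printed counterpart NAMED ONLY: Aguado–Seiler 2005 (negativity of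
the topological charge correlator away from contact, from reflection positivity).

## What is proved (torus `(ℤ/L)⁴`, `L` even, compact `G`, continuous unitary `ρ`, Wilson measure `μ_β`; `C(s) = E_β[Q_0 Q_s]`)

* §1 **`wilson_slabCorrelator_nonpos_of_even`** — `E_β[Q_a Q_{a + s}] ≤ 0` for every slice `a` and every EVEN separation
  `s = L − 2m`, `1 ≤ m ≤ L/2 − 1`, EVERY real `β` (site reflection + translation);
  **`wilson_slabCorrelator_nonpos_of_odd`** — the same for every ODD separation `s = L + 1 − 2m`, `2 ≤ m ≤ L/2 − 1`, `β ≥ 0`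
  (link reflection + translation); together **`wilson_slabCorrelator_nonpos`** — for `β ≥ 0`, EVERY `s` with `2 ≤ s ≤ L − 2`:
  `E_β[Q_a Q_{a+s}] ≤ 0`.  On the finite periodic lattice the time-slice charge correlator is non-positive at every separation
  except the contact ones `s ∈ {0, ±1}`.
* §2 `zmod_val_mem_of_ne` (a residue other than `0, 1, −1` has `2 ≤ val ≤ L − 2`) and
  **`wilson_integral_sq_cloverCharge_le_contact`** — THE SUSCEPTIBILITY IS CARRIED BY THE CONTACT SLABS:
  `E_β[(Σ_x P_x)²] ≤ L·(C(0) + C(1) + C(−1)) = L·(C(0) + 2C(1))` (`β ≥ 0`, `L ≥ 4` even).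
* §3 SINGLE DENSITIES along the time axis (translation of the reflected pairs of `ChargeSlabCorrelatorRP` by row 21's
  `Scoring/TranslationAverageTwoPoint.integral_siteField_mul_translate`): **`wilson_chargeDensity_temporal_nonpos`** —
  `E_β[P_x · P_{x + s e₀}] ≤ 0` for EVERY site `x` and every `2 ≤ s ≤ L − 2` (`β ≥ 0`; the even separations for every `β`,
  `wilson_chargeDensity_temporal_nonpos_of_even`).
NOT CLAIMED: the size or sign of the contact terms; separations with a spatial component; anything for the flowed / cooled
charge (the reflection-positivity support hypothesis moves with the smoothing footprint); lower bounds; odd `L`; `β < 0` at odd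
separations; numbers.
-/

noncomputable section

namespace Summit.Ventures.LatticeQCDFlow.Exactness

open MeasureTheory
open Literature.MathematicalPhysics.QuantumFieldTheory
open Literature.MathematicalPhysics.QuantumLattice (cloverPseudoscalar continuous_cloverPseudoscalar)
open Summit.Ventures.LatticeQCDFlow.Scoring (integral_slabSum_mul_slabSum_translate integral_slabSum_mul_slabSum_swap
  wilson_integral_sq_cloverCharge_eq_card_mul_sum_slab cloverPseudoscalar_torusConfigShift)

variable {L N : ℕ} [NeZero L] [Fact (1 < L)] {G : Type*} [Group G] [TopologicalSpace G] [IsTopologicalGroup G]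
  [CompactSpace G] [MeasurableSpace G] [BorelSpace G] [SecondCountableTopology G] (ρ : G →* Matrix (Fin N) (Fin N) ℂ)

/-! ## §1 Every separation `2 ≤ s ≤ L − 2` -/

/-- **EVEN SEPARATIONS, EVERY `β`: `E_β[Q_a · Q_{a − 2m}] ≤ 0`** for every slice `a` and `1 ≤ m ≤ L/2 − 1` (separation
`L − 2m ∈ {2, 4, …, L − 2}`): the site-reflected pair `(m, −m)` translated by `a − m`. -/
theorem wilson_slabCorrelator_nonpos_of_even (hL : Even L) (hρc : Continuous ρ)
    (hρu : ∀ g, ρ g ∈ Matrix.unitaryGroup (Fin N) ℂ) (β : ℝ) {m : ℕ} (h1 : 1 ≤ m) (hm : m + 1 ≤ L / 2) (a : ZMod L) :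
    ∫ U, (∑ x ∈ Finset.univ.filter (fun x : Site 4 L => x 0 = a), cloverPseudoscalar ρ x U) *
        (∑ x ∈ Finset.univ.filter (fun x : Site 4 L => x 0 = a - 2 * (m : ZMod L)), cloverPseudoscalar ρ x U)
      ∂(wilsonMeasure ρ β) ≤ 0 := by
  have h := integral_slabCharge_mul_slabCharge_negReflect_nonpos ρ hL hρc hρu β h1 hm
  rw [integral_slabSum_mul_slabSum_translate (fun v => wilsonMeasure_map_torusConfigShift ρ β v)
    (fun x U => cloverPseudoscalar ρ x U) (fun v x U => cloverPseudoscalar_torusConfigShift ρ v x U)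
    (m : ZMod L) (-(m : ZMod L)) (a - (m : ZMod L))] at h
  have e1 : (m : ZMod L) + (a - (m : ZMod L)) = a := by ring
  have e2 : -(m : ZMod L) + (a - (m : ZMod L)) = a - 2 * (m : ZMod L) := by ring
  rw [e1, e2] at h
  exact h

/-- **ODD SEPARATIONS, `β ≥ 0`: `E_β[Q_a · Q_{a + 1 − 2m}] ≤ 0`** for every slice `a` and `2 ≤ m ≤ L/2 − 1` (separation
`L + 1 − 2m ∈ {3, 5, …, L − 3}`): the link-reflected pair `(m, 1 − m)` translated by `a − m`. -/
theorem wilson_slabCorrelator_nonpos_of_odd (hL : Even L) (hρc : Continuous ρ)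
    (hρu : ∀ g, ρ g ∈ Matrix.unitaryGroup (Fin N) ℂ) {β : ℝ} (hβ : 0 ≤ β) {m : ℕ} (h2 : 2 ≤ m) (hm : m + 1 ≤ L / 2)
    (a : ZMod L) :
    ∫ U, (∑ x ∈ Finset.univ.filter (fun x : Site 4 L => x 0 = a), cloverPseudoscalar ρ x U) *
        (∑ x ∈ Finset.univ.filter (fun x : Site 4 L => x 0 = a + 1 - 2 * (m : ZMod L)), cloverPseudoscalar ρ x U)
      ∂(wilsonMeasure ρ β) ≤ 0 := by
  have h := integral_slabCharge_mul_slabCharge_timeReflect_nonpos ρ hL hρc hρu hβ h2 hm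
  rw [integral_slabSum_mul_slabSum_translate (fun v => wilsonMeasure_map_torusConfigShift ρ β v)
    (fun x U => cloverPseudoscalar ρ x U) (fun v x U => cloverPseudoscalar_torusConfigShift ρ v x U)
    (m : ZMod L) (1 - (m : ZMod L)) (a - (m : ZMod L))] at h
  have e1 : (m : ZMod L) + (a - (m : ZMod L)) = a := by ring
  have e2 : 1 - (m : ZMod L) + (a - (m : ZMod L)) = a + 1 - 2 * (m : ZMod L) := by ring
  rw [e1, e2] at h
  exact h

/-- **EVERY SEPARATION `2 ≤ s ≤ L − 2` (`β ≥ 0`, `L` even): `E_β[Q_a · Q_{a+s}] ≤ 0`.** -/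
theorem wilson_slabCorrelator_nonpos (hL : Even L) (hρc : Continuous ρ) (hρu : ∀ g, ρ g ∈ Matrix.unitaryGroup (Fin N) ℂ)
    {β : ℝ} (hβ : 0 ≤ β) {s : ℕ} (hs2 : 2 ≤ s) (hsL : s + 2 ≤ L) (a : ZMod L) :
    ∫ U, (∑ x ∈ Finset.univ.filter (fun x : Site 4 L => x 0 = a), cloverPseudoscalar ρ x U) *
        (∑ x ∈ Finset.univ.filter (fun x : Site 4 L => x 0 = a + (s : ZMod L)), cloverPseudoscalar ρ x U)
      ∂(wilsonMeasure ρ β) ≤ 0 := by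
  obtain ⟨K, hK⟩ := hL
  have hL0 : ((L : ℕ) : ZMod L) = 0 := ZMod.natCast_self L
  rcases Nat.even_or_odd s with ⟨j, hj⟩ | ⟨j, hj⟩
  · -- even separation `s = 2j`: site pair with `m = K − j`
    have h := wilson_slabCorrelator_nonpos_of_even ρ ⟨K, hK⟩ hρc hρu β (m := K - j) (by omega) (by omega) a
    have e : a + (s : ZMod L) = a - 2 * ((K - j : ℕ) : ZMod L) := by
      have hc : ((s + 2 * (K - j) : ℕ) : ZMod L) = 0 := by rw [show s + 2 * (K - j) = L by omega]; exact hL0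
      push_cast at hc
      linear_combination hc
    rw [e]; exact h
  · -- odd separation `s = 2j + 1`: link pair with `m = K − j`
    have h := wilson_slabCorrelator_nonpos_of_odd ρ ⟨K, hK⟩ hρc hρu hβ (m := K - j) (by omega) (by omega) a
    have e : a + (s : ZMod L) = a + 1 - 2 * ((K - j : ℕ) : ZMod L) := by
      have hc : ((s + 2 * (K - j) : ℕ) : ZMod L) = ((L + 1 : ℕ) : ZMod L) := by rw [show s + 2 * (K - j) = L + 1 by omega]
      push_cast at hc
      rw [hL0, zero_add] at hc
      linear_combination hc
    rw [e]; exact h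

/-! ## §2 The susceptibility is bounded by its contact terms -/

omit [Fact (1 < L)] in
/-- A residue mod `L` other than `0`, `1`, `−1` has `2 ≤ val ≤ L − 2`. -/
theorem zmod_val_mem_of_ne {s : ZMod L} (h0 : s ≠ 0) (h1 : s ≠ 1) (hm1 : s ≠ -1) : 2 ≤ s.val ∧ s.val + 2 ≤ L := by
  have hlt : s.val < L := ZMod.val_lt s
  have hv0 : s.val ≠ 0 := fun h => h0 ((ZMod.val_eq_zero s).1 h)
  have hv1 : s.val ≠ 1 := by
    intro h
    apply h1
    have := ZMod.natCast_zmod_val s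
    rw [h, Nat.cast_one] at this
    exact this.symm
  have hvm : s.val ≠ L - 1 := by
    intro h
    apply hm1
    have e := ZMod.natCast_zmod_val s
    rw [h] at e
    rw [← e, Nat.cast_sub (NeZero.one_le), Nat.cast_one, ZMod.natCast_self, zero_sub]
  omega

/-- **THE SUSCEPTIBILITY IS CARRIED BY THE CONTACT SLABS: `E_β[(Σ_x P_x)²] ≤ L · (C(0) + C(1) + C(−1))`** with
`C(s) = E_β[Q_0 Q_s]`, for `β ≥ 0` and even `L ≥ 4`; and `C(−1) = C(1)`, so the bound is `L · (C(0) + 2C(1))`. -/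
theorem wilson_integral_sq_cloverCharge_le_contact (hL : Even L) (hL4 : 4 ≤ L) (hρc : Continuous ρ)
    (hρu : ∀ g, ρ g ∈ Matrix.unitaryGroup (Fin N) ℂ) {β : ℝ} (hβ : 0 ≤ β) :
    ∫ U, (∑ x : Site 4 L, cloverPseudoscalar ρ x U) ^ 2 ∂(wilsonMeasure ρ β) ≤
      (L : ℝ) * ((∫ U, (∑ x ∈ Finset.univ.filter (fun x : Site 4 L => x 0 = 0), cloverPseudoscalar ρ x U) *
            (∑ x ∈ Finset.univ.filter (fun x : Site 4 L => x 0 = 0), cloverPseudoscalar ρ x U) ∂(wilsonMeasure ρ β)) +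
        2 * ∫ U, (∑ x ∈ Finset.univ.filter (fun x : Site 4 L => x 0 = 0), cloverPseudoscalar ρ x U) *
            (∑ x ∈ Finset.univ.filter (fun x : Site 4 L => x 0 = 1), cloverPseudoscalar ρ x U) ∂(wilsonMeasure ρ β)) := by
  -- the slab decomposition
  rw [wilson_integral_sq_cloverCharge_eq_card_mul_sum_slab ρ hρc β]
  set C : ZMod L → ℝ := fun s => ∫ U, (∑ x ∈ Finset.univ.filter (fun x : Site 4 L => x 0 = 0), cloverPseudoscalar ρ x U) *
      (∑ x ∈ Finset.univ.filter (fun x : Site 4 L => x 0 = s), cloverPseudoscalar ρ x U) ∂(wilsonMeasure ρ β) with hCdef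
  -- the three contact residues are distinct (`L ≥ 4`)
  haveI : Fact (2 < L) := ⟨by omega⟩
  have h01 : (0 : ZMod L) ≠ 1 := zero_ne_one
  have h0m : (0 : ZMod L) ≠ -1 := fun h => by
    have := congrArg (fun z : ZMod L => z + 1) h
    simp only [zero_add, neg_add_cancel] at this
    exact one_ne_zero this
  have h1m : (1 : ZMod L) ≠ -1 := fun h => by
    have h2 : (2 : ZMod L) = 0 := by linear_combination h
    have h3 : ((2 : ℕ) : ZMod L) = 0 := by exact_mod_cast h2
    rw [ZMod.natCast_eq_zero_iff] at h3
    exact absurd (Nat.le_of_dvd two_pos h3) (by omega)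
  -- split the sum into the contact set and the rest
  set T : Finset (ZMod L) := {0, 1, -1} with hT
  have hsplit : ∑ s : ZMod L, C s = ∑ s ∈ T, C s + ∑ s ∈ Finset.univ \ T, C s := by
    rw [← Finset.sum_add_sum_compl T C, Finset.compl_eq_univ_sdiff]
  have hrest : ∑ s ∈ Finset.univ \ T, C s ≤ 0 := by
    refine Finset.sum_nonpos fun s hs => ?_
    simp only [Finset.mem_sdiff, Finset.mem_univ, true_and, hT, Finset.mem_insert, Finset.mem_singleton, not_or] at hs
    obtain ⟨hv2, hvL⟩ := zmod_val_mem_of_ne hs.1 hs.2.1 hs.2.2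
    have h := wilson_slabCorrelator_nonpos ρ hL hρc hρu hβ hv2 hvL 0
    simp only [zero_add, ZMod.natCast_zmod_val] at h
    exact h
  have hT3 : ∑ s ∈ T, C s = C 0 + C 1 + C (-1) := by
    rw [hT, Finset.sum_insert (by simp [h01, h0m]), Finset.sum_insert (by simp [h1m]), Finset.sum_singleton]
    ring
  have hsym : C (-1) = C 1 := by
    simp only [hCdef]
    rw [integral_slabSum_mul_slabSum_swap (fun v => wilsonMeasure_map_torusConfigShift ρ β v)
      (fun x U => cloverPseudoscalar ρ x U) (fun v x U => cloverPseudoscalar_torusConfigShift ρ v x U) (1 : ZMod L)]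
  have hLpos : (0 : ℝ) ≤ L := Nat.cast_nonneg L
  calc (L : ℝ) * ∑ s : ZMod L, C s = (L : ℝ) * (∑ s ∈ T, C s + ∑ s ∈ Finset.univ \ T, C s) := by rw [hsplit]
    _ ≤ (L : ℝ) * (∑ s ∈ T, C s) := by nlinarith
    _ = (L : ℝ) * (C 0 + 2 * C 1) := by rw [hT3, hsym]; ring

/-! ## §3 Single densities at purely temporal separations -/

/-- **SINGLE DENSITIES, EVEN TEMPORAL SEPARATION, EVERY `β`: `E_β[P_x · P_{x + (L − 2m)e₀}] ≤ 0`** for every site `x` and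
`1 ≤ m ≤ L/2 − 1` (the site-reflected pair through the slice `m` above `x`'s spatial position, translated back). -/
theorem wilson_chargeDensity_temporal_nonpos_of_even (hL : Even L) (hρc : Continuous ρ)
    (hρu : ∀ g, ρ g ∈ Matrix.unitaryGroup (Fin N) ℂ) (β : ℝ) {m : ℕ} (h1 : 1 ≤ m) (hm : m + 1 ≤ L / 2) (x : Site 4 L) :
    ∫ U, cloverPseudoscalar ρ x U * cloverPseudoscalar ρ (x - Pi.single 0 (2 * (m : ZMod L))) U ∂(wilsonMeasure ρ β) ≤ 0 := by
  -- the reflected pair `(y, θ'y)` with `y = x + (m − x₀) e₀`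
  set y : Site 4 L := x + Pi.single 0 ((m : ZMod L) - x 0) with hy
  have hy0 : y 0 = (m : ZMod L) := by simp [hy]
  have h := integral_cloverPseudoscalar_mul_negReflect_nonpos ρ hL hρc hρu β y hy0 h1 hm
  have hμ := fun v => wilsonMeasure_map_torusConfigShift (d := 4) (L := L) ρ β v
  rw [Scoring.integral_siteField_mul_translate hμ (fun z U => cloverPseudoscalar ρ z U) (fun z U => cloverPseudoscalar ρ z U)
    (fun v z U => cloverPseudoscalar_torusConfigShift ρ v z U) (fun v z U => cloverPseudoscalar_torusConfigShift ρ v z U)] at h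
  rw [Scoring.integral_siteField_mul_translate hμ (fun z U => cloverPseudoscalar ρ z U) (fun z U => cloverPseudoscalar ρ z U)
    (fun v z U => cloverPseudoscalar_torusConfigShift ρ v z U) (fun v z U => cloverPseudoscalar_torusConfigShift ρ v z U)]
  have e : Site.negReflect y - y = x - Pi.single 0 (2 * (m : ZMod L)) - x := by
    funext k
    by_cases hk : k = 0
    · subst hk; simp [Site.negReflect, hy]; ring
    · simp [Site.negReflect, hy, hk]
  rw [← e]
  exact h

/-- **SINGLE DENSITIES, ODD TEMPORAL SEPARATION, `β ≥ 0`: `E_β[P_x · P_{x + (L + 1 − 2m)e₀}] ≤ 0`** for every site `x` and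
`2 ≤ m ≤ L/2 − 1` (the link-reflected pair, translated back). -/
theorem wilson_chargeDensity_temporal_nonpos_of_odd (hL : Even L) (hρc : Continuous ρ)
    (hρu : ∀ g, ρ g ∈ Matrix.unitaryGroup (Fin N) ℂ) {β : ℝ} (hβ : 0 ≤ β) {m : ℕ} (h2 : 2 ≤ m) (hm : m + 1 ≤ L / 2)
    (x : Site 4 L) :
    ∫ U, cloverPseudoscalar ρ x U * cloverPseudoscalar ρ (x + Pi.single 0 (1 - 2 * (m : ZMod L))) U ∂(wilsonMeasure ρ β) ≤ 0 := by
  set y : Site 4 L := x + Pi.single 0 ((m : ZMod L) - x 0) with hy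
  have hy0 : y 0 = (m : ZMod L) := by simp [hy]
  have h := integral_cloverPseudoscalar_mul_timeReflect_nonpos ρ hL hρc hρu hβ y hy0 h2 hm
  have hμ := fun v => wilsonMeasure_map_torusConfigShift (d := 4) (L := L) ρ β v
  rw [Scoring.integral_siteField_mul_translate hμ (fun z U => cloverPseudoscalar ρ z U) (fun z U => cloverPseudoscalar ρ z U)
    (fun v z U => cloverPseudoscalar_torusConfigShift ρ v z U) (fun v z U => cloverPseudoscalar_torusConfigShift ρ v z U)] at h
  rw [Scoring.integral_siteField_mul_translate hμ (fun z U => cloverPseudoscalar ρ z U) (fun z U => cloverPseudoscalar ρ z U)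
    (fun v z U => cloverPseudoscalar_torusConfigShift ρ v z U) (fun v z U => cloverPseudoscalar_torusConfigShift ρ v z U)]
  have e : Site.timeReflect y - y = x + Pi.single 0 (1 - 2 * (m : ZMod L)) - x := by
    funext k
    by_cases hk : k = 0
    · subst hk; simp [Site.timeReflect, hy]; ring
    · simp [Site.timeReflect, hy, hk]
  rw [← e]
  exact h

/-- **EVERY PURELY TEMPORAL SEPARATION `2 ≤ s ≤ L − 2` (`β ≥ 0`): `E_β[P_x · P_{x + s e₀}] ≤ 0`** — the bare clover-charge
two-point function is non-positive along the time axis beyond contact, at every site. -/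
theorem wilson_chargeDensity_temporal_nonpos (hL : Even L) (hρc : Continuous ρ)
    (hρu : ∀ g, ρ g ∈ Matrix.unitaryGroup (Fin N) ℂ) {β : ℝ} (hβ : 0 ≤ β) {s : ℕ} (hs2 : 2 ≤ s) (hsL : s + 2 ≤ L)
    (x : Site 4 L) :
    ∫ U, cloverPseudoscalar ρ x U * cloverPseudoscalar ρ (x + Pi.single 0 (s : ZMod L)) U ∂(wilsonMeasure ρ β) ≤ 0 := by
  obtain ⟨K, hK⟩ := hL
  have hL0 : ((L : ℕ) : ZMod L) = 0 := ZMod.natCast_self L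
  rcases Nat.even_or_odd s with ⟨j, hj⟩ | ⟨j, hj⟩
  · have h := wilson_chargeDensity_temporal_nonpos_of_even ρ ⟨K, hK⟩ hρc hρu β (m := K - j) (by omega) (by omega) x
    have e : x + Pi.single (0 : Fin 4) ((s : ℕ) : ZMod L) = x - Pi.single 0 (2 * ((K - j : ℕ) : ZMod L)) := by
      have hc : ((s + 2 * (K - j) : ℕ) : ZMod L) = 0 := by rw [show s + 2 * (K - j) = L by omega]; exact hL0
      push_cast at hc
      rw [sub_eq_add_neg, ← Pi.single_neg]
      congr 1
      congr 1
      linear_combination hc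
    rw [e]; exact h
  · have h := wilson_chargeDensity_temporal_nonpos_of_odd ρ ⟨K, hK⟩ hρc hρu hβ (m := K - j) (by omega) (by omega) x
    have e : x + Pi.single (0 : Fin 4) ((s : ℕ) : ZMod L) = x + Pi.single 0 (1 - 2 * ((K - j : ℕ) : ZMod L)) := by
      have hc : ((s + 2 * (K - j) : ℕ) : ZMod L) = ((L + 1 : ℕ) : ZMod L) := by rw [show s + 2 * (K - j) = L + 1 by omega]
      push_cast at hc
      rw [hL0, zero_add] at hc
      congr 1
      congr 1
      linear_combination hc
    rw [e]; exact h

end Summit.Ventures.LatticeQCDFlow.Exactness
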